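import Summits.BirchSwinnertonDyer.Rank1Residual.Iwasawa.UnitCoefficientFromRiemannSum
import Literature.NumberTheory.EllipticCurves.PAdicLFunctionRiemannSumCongruenceCertificateProofs
import Literature.NumberTheory.EllipticCurves.PlusSymbolBoundOddMultiplicativeProofs
import HarnessLib

/-!
# The unit-coefficient certificate from ONE Riemann sum read MODULO `p` (`k < p^{n₀}`,
# `C·p⁻¹ < ‖RS k n₀‖`), at a multiplicative prime — and WITHOUT the symbol-bound clause at an odd
# multiplicative prime in positive analytic rank (cell `b2b-bsdres`, lane CLASS-CLOSURE, seat
# `cc-typer-3` GEN 8; kernel companion of `Iwasawa/UnitCoefficientFromRiemannSum.lean` (iw-1) and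
# `Iwasawa/UnitCoefficientFromRiemannSumIntegral.lean` (cc-typer-6 GEN 10))

HONEST FRAMING (run/shared/lean/b2b/bsd-rank1-residual/, verbatim in every file): prove what is
provable now; shrink each hard class to its core with data; no claim beyond stated classes.
Theorems only; no definition, no named fact; nothing about any particular curve is asserted; nothing
is booked; census / instrument output is EVIDENCE, never a Literature fact.

## What this file proves

The certificate currency of `UnitCoefficientFromRiemannSum.lean` decides `‖[T^k](ϖ·L_p)‖_p = 1`
from ONE Riemann sum through the TRUNCATION inequality `(C/‖k!‖_p)·p^{−n₀} < ‖RS k n₀‖`, which for a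
large index `k = λ` asks for a deep level (`n₀ > v_p(k!) + log_p C`; `λ = 52` at `p = 7` needs
`n₀ ≥ 9`). The Literature file `PAdicLFunctionRiemannSumCongruenceCertificateProofs` proves the
classical algebraic companion (Mazur–Tate–Teitelbaum 1986 §I.12–I.13: the level-`n₀` Riemann
polynomial is the transform modulo `ω_{n₀} ≡ T^{p^{n₀}} (mod p)`, via Lucas): for `k < p^{n₀}`,
`‖[T^k]L − RS k n₀‖ ≤ C·p⁻¹`, so `C·p⁻¹ < ‖RS k n₀‖` certifies `‖[T^k]L‖ = ‖RS k n₀‖`. Hence: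

* `unitCoeffAt_of_lt_pow` — per newform `f` of `W` and `ϖ` with `ϖ·Ω_E = Ω⁺_f`: a symbol bound `C`
  (all levels), ONE level `n₀` with `p^{n₀} > k`, `C·p⁻¹ < ‖RS k n₀‖` and `‖ϖ·RS k n₀‖ = 1`
  (`k = n` non-split, signed sums; `k = n + 1` split) ⟹ `UnitCoeffAt W p n`;
* `unitCoeffAt_of_lt_pow_of_analyticRank_ne_zero` — at an ODD multiplicative prime in POSITIVE
  analytic rank the bound holds with `C = 1`
  (`IsNewformOf.norm_ratPlusSymbol_val_div_le_one_of_multiplicative_of_analyticRank_ne_zero`), so the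
  datum is: `p^{n₀} > k`, `p⁻¹ < ‖RS k n₀‖`, `‖ϖ·RS k n₀‖ = 1` — and when `ϖ` is a `p`-adic integer
  the middle clause follows from the last;
* `muAnZeroAt_of_lt_pow_of_analyticRank_ne_zero` — hence x11a's `μ_an(E,p) = 0` shape.

This is the kernel form of the (μ, λ)-census fold's mod-`p` reading `[T^j](ϖ·L_p) ≡ b_j (mod p)`,
`j < p^{n₀}` (HOME/class-closure/eng-6/n8-mu/INSTANTIATION-NOTE.md §3; census-ctyper-2's
`MUSPEC-INST-on-t0-JOIN` class `MODP`): those rows become literal certificate instances at the levels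
actually tabled. Everything downstream of `UnitCoeffAt` (squeeze / minimal pairs / Schneider ∧ `Ш`
finite; N8's and O9's consumers) applies unchanged. Nothing booked.

References: [MazurTateTeitelbaum1986Invent] §I.4 (4.2), §I.8, §I.10, §I.12–I.13; [SteinWuthrich2013]
§3, §4.2; [CremonaAlgorithms1997] §2.2 Lemma 2.2.3; [GreenbergVatsal2000] p. 2–4;
HOME/class-closure/O2/TYPER-3.md §14.
-/

noncomputable section

open scoped Classical MatrixGroups ModularForm

open CongruenceSubgroup WeierstrassCurve Literature.NumberTheory.EllipticCurves
  Literature.NumberTheory.EllipticCurves.ModularForms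

set_option autoImplicit false

namespace Summit.BirchSwinnertonDyer.Rank1Residual.Iwasawa

variable {W : WeierstrassCurve ℚ} {p : ℕ} [Fact p.Prime]

/-- **`UnitCoeffAt W p n` from ONE Riemann sum read modulo `p`**, at a multiplicative prime: per
newform `f` of `W` and `ϖ` with `ϖ·Ω_E = Ω⁺_f`, a plus-symbol bound `C` (all levels), a level `n₀`
with `p^{n₀} > k`, `C·p⁻¹ < ‖RS k n₀‖` and `‖ϖ·RS k n₀‖_p = 1` at `k = n` (non-split: signed measure,
THE function `IsMultPAdicLFunctionOf f p (-1)`) resp. `k = n + 1` (split, THE function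
`IsSplitMultPAdicLFunctionOf f p`). [cite: MazurTateTeitelbaum1986Invent, §I.10 Prop., §I.12–I.13]
[cite: SteinWuthrich2013, §3 and §4.2] -/
theorem unitCoeffAt_of_lt_pow (hmult : W.HasMultiplicativeReductionAtPrime p) {n : ℕ}
    (h : ∀ {N : ℕ} [NeZero N] (f : CuspForm (Gamma0 N) 2), IsNewformOf W f →
      ∀ (ϖ : ℚ), (ϖ : ℝ) * W.realPeriodRat = plusPeriod f →
        (¬ W.HasSplitMultiplicativeReductionAtPrime p →
          ∃ (C : ℝ) (n₀ : ℕ) (RS : ℕ → ℕ → ℚ_[p]),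
            (∀ k m : ℕ, RS k m =
              ∑ᶠ ξ : rootsOfUnity (torsionOrder p) ℤ_[p], ∑ s : ZMod (p ^ m),
                (fun (m : ℕ) (a : ZMod (p ^ m)) ↦
                    (-1 : ℚ_[p]) ^ m * (ratPlusSymbol f ((a.val : ℚ) / (p : ℚ) ^ m) : ℚ_[p]))
                  (m + cyclotomicExponent p)
                    (PadicInt.toZModPow (m + cyclotomicExponent p) ((ξ : ℤ_[p]ˣ) : ℤ_[p]) *
                      (cyclotomicGenerator p : ZMod (p ^ (m + cyclotomicExponent p))) ^ s.val) *
                  ((s.val.choose k : ℕ) : ℚ_[p])) ∧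
            (∀ (m : ℕ) (a : ZMod (p ^ m)),
              ‖(ratPlusSymbol f ((a.val : ℚ) / (p : ℚ) ^ m) : ℚ_[p])‖ ≤ C) ∧
            n < p ^ n₀ ∧ C * (p : ℝ)⁻¹ < ‖RS n n₀‖ ∧ ‖((ϖ : ℚ) : ℚ_[p]) * RS n n₀‖ = 1) ∧
        (W.HasSplitMultiplicativeReductionAtPrime p →
          ∃ (C : ℝ) (n₀ : ℕ) (RS : ℕ → ℕ → ℚ_[p]),
            (∀ k m : ℕ, RS k m =
              ∑ᶠ ξ : rootsOfUnity (torsionOrder p) ℤ_[p], ∑ s : ZMod (p ^ m),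
                (fun (m : ℕ) (a : ZMod (p ^ m)) ↦
                    (ratPlusSymbol f ((a.val : ℚ) / (p : ℚ) ^ m) : ℚ_[p]))
                  (m + cyclotomicExponent p)
                    (PadicInt.toZModPow (m + cyclotomicExponent p) ((ξ : ℤ_[p]ˣ) : ℤ_[p]) *
                      (cyclotomicGenerator p : ZMod (p ^ (m + cyclotomicExponent p))) ^ s.val) *
                  ((s.val.choose k : ℕ) : ℚ_[p])) ∧
            (∀ (m : ℕ) (a : ZMod (p ^ m)),
              ‖(ratPlusSymbol f ((a.val : ℚ) / (p : ℚ) ^ m) : ℚ_[p])‖ ≤ C) ∧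
            n + 1 < p ^ n₀ ∧ C * (p : ℝ)⁻¹ < ‖RS (n + 1) n₀‖ ∧
            ‖((ϖ : ℚ) : ℚ_[p]) * RS (n + 1) n₀‖ = 1)) :
    UnitCoeffAt W p n := by
  intro N _ f hf ϖ hϖ
  obtain ⟨hns, hs⟩ := h f hf ϖ hϖ
  refine ⟨fun h' L hL ↦ ?_, fun h' L hL ↦ ?_⟩
  · obtain ⟨C, n₀, RS, hRS, hC, hk, hlt, hunit⟩ := hns h'
    exact norm_coeff_C_mul_eq_one_of_norm_eq
      (hL.norm_coeff_eq_of_nonsplit_of_mul_inv_lt hRS hf hmult h' hC hk hlt).1 hunit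
  · obtain ⟨C, n₀, RS, hRS, hC, hk, hlt, hunit⟩ := hs h'
    exact norm_coeff_C_mul_eq_one_of_norm_eq
      (hL.norm_coeff_eq_of_split_of_mul_inv_lt hRS h' hf hC hk hlt).1 hunit

/-- **`UnitCoeffAt W p n` from ONE Riemann sum read modulo `p`, WITHOUT the symbol-bound clause**,
at an ODD multiplicative prime in POSITIVE analytic rank: the bound `‖[a/pᵐ]⁺_f‖_p ≤ 1` over all
levels is the tree theorem
`IsNewformOf.norm_ratPlusSymbol_val_div_le_one_of_multiplicative_of_analyticRank_ne_zero` (cusp class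
of `1/p` at `p ∥ N`, `U_p` at the cusp `0`, `[0]⁺_f = L(E,1)/Ω⁺_f = 0`), so the per-`(f, ϖ)` datum is:
ONE level `n₀` with `p^{n₀} > k`, `p⁻¹ < ‖RS k n₀‖` and `‖ϖ·RS k n₀‖_p = 1` (`k = n` non-split,
`k = n + 1` split). [cite: MazurTateTeitelbaum1986Invent, §I.4 (4.2), §I.8, §I.10 and §I.12–I.13]
[cite: CremonaAlgorithms1997, §2.2 Lemma 2.2.3] [cite: SteinWuthrich2013, §3 and §4.2] -/
theorem unitCoeffAt_of_lt_pow_of_analyticRank_ne_zero (hp2 : p ≠ 2)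
    (hmult : W.HasMultiplicativeReductionAtPrime p) (hr : W.analyticRank ≠ 0) {n : ℕ}
    (h : ∀ {N : ℕ} [NeZero N] (f : CuspForm (Gamma0 N) 2), IsNewformOf W f →
      ∀ (ϖ : ℚ), (ϖ : ℝ) * W.realPeriodRat = plusPeriod f →
        (¬ W.HasSplitMultiplicativeReductionAtPrime p →
          ∃ (n₀ : ℕ) (RS : ℕ → ℕ → ℚ_[p]),
            (∀ k m : ℕ, RS k m =
              ∑ᶠ ξ : rootsOfUnity (torsionOrder p) ℤ_[p], ∑ s : ZMod (p ^ m),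
                (fun (m : ℕ) (a : ZMod (p ^ m)) ↦
                    (-1 : ℚ_[p]) ^ m * (ratPlusSymbol f ((a.val : ℚ) / (p : ℚ) ^ m) : ℚ_[p]))
                  (m + cyclotomicExponent p)
                    (PadicInt.toZModPow (m + cyclotomicExponent p) ((ξ : ℤ_[p]ˣ) : ℤ_[p]) *
                      (cyclotomicGenerator p : ZMod (p ^ (m + cyclotomicExponent p))) ^ s.val) *
                  ((s.val.choose k : ℕ) : ℚ_[p])) ∧
            n < p ^ n₀ ∧ (p : ℝ)⁻¹ < ‖RS n n₀‖ ∧ ‖((ϖ : ℚ) : ℚ_[p]) * RS n n₀‖ = 1) ∧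
        (W.HasSplitMultiplicativeReductionAtPrime p →
          ∃ (n₀ : ℕ) (RS : ℕ → ℕ → ℚ_[p]),
            (∀ k m : ℕ, RS k m =
              ∑ᶠ ξ : rootsOfUnity (torsionOrder p) ℤ_[p], ∑ s : ZMod (p ^ m),
                (fun (m : ℕ) (a : ZMod (p ^ m)) ↦
                    (ratPlusSymbol f ((a.val : ℚ) / (p : ℚ) ^ m) : ℚ_[p]))
                  (m + cyclotomicExponent p)
                    (PadicInt.toZModPow (m + cyclotomicExponent p) ((ξ : ℤ_[p]ˣ) : ℤ_[p]) *
                      (cyclotomicGenerator p : ZMod (p ^ (m + cyclotomicExponent p))) ^ s.val) *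
                  ((s.val.choose k : ℕ) : ℚ_[p])) ∧
            n + 1 < p ^ n₀ ∧ (p : ℝ)⁻¹ < ‖RS (n + 1) n₀‖ ∧
            ‖((ϖ : ℚ) : ℚ_[p]) * RS (n + 1) n₀‖ = 1)) :
    UnitCoeffAt W p n := by
  apply unitCoeffAt_of_lt_pow hmult
  intro N _ f hf ϖ hϖ
  have hC : ∀ (m : ℕ) (a : ZMod (p ^ m)),
      ‖(ratPlusSymbol f ((a.val : ℚ) / (p : ℚ) ^ m) : ℚ_[p])‖ ≤ 1 :=
    fun m a ↦ hf.norm_ratPlusSymbol_val_div_le_one_of_multiplicative_of_analyticRank_ne_zero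
      hp2 hmult hr m a
  obtain ⟨hns, hs⟩ := h f hf ϖ hϖ
  refine ⟨fun h' ↦ ?_, fun h' ↦ ?_⟩
  · obtain ⟨n₀, RS, hRS, hk, hlt, hunit⟩ := hns h'
    exact ⟨1, n₀, RS, hRS, hC, hk, by rwa [one_mul], hunit⟩
  · obtain ⟨n₀, RS, hRS, hk, hlt, hunit⟩ := hs h'
    exact ⟨1, n₀, RS, hRS, hC, hk, by rwa [one_mul], hunit⟩

/-- When `ϖ` is a `p`-adic integer the inequality clause is implied by the unit clause:
`‖ϖ·RS‖ = 1` and `‖ϖ‖ ≤ 1` give `‖RS‖ ≥ 1 > p⁻¹`. [folklore] -/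
theorem inv_lt_norm_of_norm_mul_eq_one {ϖ RS : ℚ_[p]} (hϖ : ‖ϖ‖ ≤ 1) (hunit : ‖ϖ * RS‖ = 1) :
    (p : ℝ)⁻¹ < ‖RS‖ := by
  have hp1 : (1 : ℝ) < p := by exact_mod_cast (Fact.out : p.Prime).one_lt
  have hinv : (p : ℝ)⁻¹ < 1 := inv_lt_one_of_one_lt₀ hp1
  refine hinv.trans_le ?_
  rw [norm_mul] at hunit
  have hRS0 : 0 ≤ ‖RS‖ := norm_nonneg _
  nlinarith [hunit, hϖ, hRS0, norm_nonneg ϖ]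

/-- Hence x11a's `μ_an(E,p) = 0` certificate `X11a.MuAnZeroAt W p` from ONE Riemann sum read modulo
`p` at any index, at an odd multiplicative prime in positive analytic rank (`muAnZeroAt_of_unitCoeffAt`).
[cite: GreenbergVatsal2000, p. 2–3, (1)–(2)] -/
theorem muAnZeroAt_of_lt_pow_of_analyticRank_ne_zero [W.IsElliptic] [W.IsGloballyMinimal]
    (hp2 : p ≠ 2) (hmult : W.HasMultiplicativeReductionAtPrime p) (hr : W.analyticRank ≠ 0) {n : ℕ}
    (h : ∀ {N : ℕ} [NeZero N] (f : CuspForm (Gamma0 N) 2), IsNewformOf W f →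
      ∀ (ϖ : ℚ), (ϖ : ℝ) * W.realPeriodRat = plusPeriod f →
        (¬ W.HasSplitMultiplicativeReductionAtPrime p →
          ∃ (n₀ : ℕ) (RS : ℕ → ℕ → ℚ_[p]),
            (∀ k m : ℕ, RS k m =
              ∑ᶠ ξ : rootsOfUnity (torsionOrder p) ℤ_[p], ∑ s : ZMod (p ^ m),
                (fun (m : ℕ) (a : ZMod (p ^ m)) ↦
                    (-1 : ℚ_[p]) ^ m * (ratPlusSymbol f ((a.val : ℚ) / (p : ℚ) ^ m) : ℚ_[p]))
                  (m + cyclotomicExponent p)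
                    (PadicInt.toZModPow (m + cyclotomicExponent p) ((ξ : ℤ_[p]ˣ) : ℤ_[p]) *
                      (cyclotomicGenerator p : ZMod (p ^ (m + cyclotomicExponent p))) ^ s.val) *
                  ((s.val.choose k : ℕ) : ℚ_[p])) ∧
            n < p ^ n₀ ∧ (p : ℝ)⁻¹ < ‖RS n n₀‖ ∧ ‖((ϖ : ℚ) : ℚ_[p]) * RS n n₀‖ = 1) ∧
        (W.HasSplitMultiplicativeReductionAtPrime p →
          ∃ (n₀ : ℕ) (RS : ℕ → ℕ → ℚ_[p]),
            (∀ k m : ℕ, RS k m =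
              ∑ᶠ ξ : rootsOfUnity (torsionOrder p) ℤ_[p], ∑ s : ZMod (p ^ m),
                (fun (m : ℕ) (a : ZMod (p ^ m)) ↦
                    (ratPlusSymbol f ((a.val : ℚ) / (p : ℚ) ^ m) : ℚ_[p]))
                  (m + cyclotomicExponent p)
                    (PadicInt.toZModPow (m + cyclotomicExponent p) ((ξ : ℤ_[p]ˣ) : ℤ_[p]) *
                      (cyclotomicGenerator p : ZMod (p ^ (m + cyclotomicExponent p))) ^ s.val) *
                  ((s.val.choose k : ℕ) : ℚ_[p])) ∧
            n + 1 < p ^ n₀ ∧ (p : ℝ)⁻¹ < ‖RS (n + 1) n₀‖ ∧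
            ‖((ϖ : ℚ) : ℚ_[p]) * RS (n + 1) n₀‖ = 1)) :
    X11a.MuAnZeroAt W p :=
  muAnZeroAt_of_unitCoeffAt (unitCoeffAt_of_lt_pow_of_analyticRank_ne_zero hp2 hmult hr h)

end Summit.BirchSwinnertonDyer.Rank1Residual.Iwasawa

end
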